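import Literature.AnabelianGeometry.EtaleTheta.Discharge.Sec2KummerTwistCor29
import HarnessLib

/-!
# [EtTh] Cor 2.9 over the typed interface, continued: the FULL typed count `Cor29_card` (all six members, dotted ones included)
# HOLDS at the Kummer-twist model — so `Cor29_card` is consistent with the interface and `Cor29_card ⇏ Cor29_preserved`

S. Mochizuki, *The étale theta function …*, Publ. RIMS **45** (2009) [MochizukiEtTh2009], §2, Cor. 2.9 p.43 (PDF): labels
`(ℤ/lℤ)^±` ↔ `Aut_K`-orbits of cusps for each of `Ẋ̲̲, Ċ̲, Ċ̲̲, X̲̲, C̲, C̲̲` (abc-iut-L2-t2's typed `TemperedCoverData.Cor29_card`,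
FACT-LIST F-0600; its universal closure is REFUTED, abc-iut-w5-d118 `TemperedModel.not_forall_cor29_card`).  abc-iut cell, seat
abc-iut-f-141; PROOF-ONLY (0 definitions), part 4 of the Kummer-twist model (`Discharge/Sec2KummerTwistCor29.lean`).

WHAT IS PROVED.  The toy normalisers `N(Π_{X̲̲}-part) = N(Π_{C̲}-part) = N(Π_{C̲̲}-part) = Π_{C̲}-part` (`normalizer_kumXuu/kumHp/kumCuu`),
the product bookkeeping `N(K × 1) = N(K) × ℤ/2` in `kumPiC × ℤ/2`, whence at the model the normaliser of each DOTTED member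
`Π^tp_Z ∩ Π^tp_Ċ` is again `Π^tp_{C̲}` and abc-iut-L2-d3's `natCard_cuspOrbits_of_normalizer_eq` (from `hC1`, `hC2`) gives `(l+1)/2`
orbits for `Ẋ̲̲, Ċ̲, Ċ̲̲` too:
* `exists_model_cor29_card` — `∃ T : TemperedCoverData l, T.HasMuL ∧ T.Cor29_card ∧ ¬ T.Cor29_preserved` (`l` odd, `l ≥ 5`):
  **the typed `Cor29_card` (F-0600) HOLDS at a kernel model** (first unconditional INSTANCE: the typed count is CONSISTENT with the
  interface + `HasMuL`, its ∀-closure being false), while the typed `Cor29_preserved` (F-0601) fails there;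
* `not_forall_cor29_preserved_of_cor29_card` — **`HasMuL ∧ Cor29_card ⇏ Cor29_preserved`**; with abc-iut-f-142's
  `not_forall_cor29_card_of_cor29_preserved` the two typed sentences of Cor 2.9 are INDEPENDENT over the interface.
HONEST LABEL: TOY; statements about the typed interface only; no side taken on [IUTchIII] Cor 3.12; typed ≠ proved.
[cite: MochizukiEtTh2009, Cor 2.9 p.43]
-/

noncomputable section

namespace Literature.AnabelianGeometry.EtaleTheta

namespace ThetaCovers

/-! ## 1. Toy normalisers: `N(Π_{X̲̲}-part) = N(Π_{C̲}-part) = N(Π_{C̲̲}-part) = Π_{C̲}-part` -/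

namespace KummerWitness

open Multiplicative HeisenbergWitness

variable (l : ℕ)

/-- The centre normalises every subgroup. (toy bookkeeping; no claim about print) [cite: MochizukiEtTh2009, Cor 2.9 p.43] -/
theorem kumZ_le_normalizer (K : Subgroup (kumPiC l)) : kumZ l ≤ Subgroup.normalizer (K : Set (kumPiC l)) := by
  rw [Subgroup.le_normalizer_iff]
  intro z hz g hg
  have h : z * g * z⁻¹ = g := by
    have := z_central l g hz
    have e : z * g * z⁻¹ = (g * z * g⁻¹ * z⁻¹)⁻¹ * g := by group
    rw [e, this, inv_one, one_mul]
  rw [h]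
  exact hg

/-- `ι = s r` normalises `Π_{X̲̲}`-part (`s r · (x, −x, z) = (−x, x, z)`). (toy bookkeeping; no claim about print) [cite: MochizukiEtTh2009, Cor 2.9 p.43] -/
theorem iota_conj_mem_kumXuu {g : kumPiC l} (hg : g ∈ kumXuu l) : iota l * g * (iota l)⁻¹ ∈ kumXuu l := by
  obtain ⟨h1, h2⟩ := hg
  refine ⟨by simp [h1], ?_⟩
  simp only [ξ_mul, υ_mul, ξ_inv, υ_inv, ζ_inv, h1, iota_right, ξ_iota, υ_iota, ζ_iota, eps_sr, aPar_sr, rotIdx_sr, qPar,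
    SemidirectProduct.mul_right, mul_one, DihedralGroup.inv_sr, sub_self]
  linear_combination h2

/-- `Π_{C̲}-part` normalises `Π_{X̲̲}`-part. (toy bookkeeping; no claim about print) [cite: MochizukiEtTh2009, Cor 2.9 p.43] -/
theorem kumHp_le_normalizer_kumXuu : kumHp l ≤ Subgroup.normalizer ((kumXuu l : Subgroup (kumPiC l)) : Set (kumPiC l)) := by
  intro h hh
  rcases hh with hh | hh
  · rw [Subgroup.mem_normalizer_iff]
    intro g
    constructor
    · intro hg
      rw [conj_eq_of_right_eq_one l hh hg.1]; exact hg
    · intro hg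
      have e : g = h⁻¹ * (h * g * h⁻¹) * h⁻¹⁻¹ := by group
      have hh' : h⁻¹.right = 1 := by rw [SemidirectProduct.inv_right, hh, inv_one]
      rw [e, conj_eq_of_right_eq_one l hh' hg.1]; exact hg
  · have hsplit : h = h * (iota l)⁻¹ * iota l := by rw [inv_mul_cancel_right]
    rw [hsplit]
    refine Subgroup.mul_mem _ ?_ ?_
    · have hh' : (h * (iota l)⁻¹).right = 1 := mul_iota_inv_mem_kumH l hh
      rw [Subgroup.mem_normalizer_iff]
      intro g
      constructor
      · intro hg
        rw [conj_eq_of_right_eq_one l hh' hg.1]; exact hg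
      · intro hg
        have e : g = (h * (iota l)⁻¹)⁻¹ * ((h * (iota l)⁻¹) * g * (h * (iota l)⁻¹)⁻¹) * (h * (iota l)⁻¹)⁻¹⁻¹ := by group
        have hh'' : (h * (iota l)⁻¹)⁻¹.right = 1 := by rw [SemidirectProduct.inv_right, hh', inv_one]
        rw [e, conj_eq_of_right_eq_one l hh'' hg.1]; exact hg
    · rw [Subgroup.mem_normalizer_iff]
      intro g
      constructor
      · exact iota_conj_mem_kumXuu l
      · intro hg
        have := iota_conj_mem_kumXuu l hg
        have e : iota l * (iota l * g * (iota l)⁻¹) * (iota l)⁻¹ = g := by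
          rw [show (iota l)⁻¹ = iota l from inv_eq_of_mul_eq_one_right (iota_mul_self l)]
          have h2 := iota_mul_self l
          calc iota l * (iota l * g * iota l) * iota l = (iota l * iota l) * g * (iota l * iota l) := by group
            _ = g := by rw [h2, one_mul, mul_one]
        rwa [e] at this

/-- Conjugating `e = (1, −1, 0) ⋊ 1 ∈ Π_{X̲̲}`-part into `Π_{X̲̲}`-part forces the `D_l`-part into `{1, s r}` (`l` odd: the sum of the
first two coordinates of `d · e` is `2i` resp. `2i − 2`). (toy bookkeeping; no claim about print) [cite: MochizukiEtTh2009, Cor 2.9 p.43] -/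
theorem mem_kumHp_of_conj_e_mem (hl : Odd l) {h : kumPiC l} (hc : h * mk l 1 (-1) 0 1 * h⁻¹ ∈ kumXuu l) : h ∈ kumHp l := by
  have h2 : IsUnit (2 : ZMod l) := by
    have := (ZMod.isUnit_iff_coprime 2 l).mpr (Nat.coprime_two_left.mpr hl)
    exact_mod_cast this
  have hx := hc.2
  rcases hr : h.right with i | i
  · simp only [ξ_mul, υ_mul, ξ_inv, υ_inv, ζ_inv, hr, eps_r, aPar_r, rotIdx_r, qPar, DihedralGroup.inv_r, ξ_mk, υ_mk, ζ_mk,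
      mk_right, SemidirectProduct.mul_right, mul_one, mul_zero, add_zero] at hx
    have hi : (2 : ZMod l) * i = 0 := by linear_combination hx
    left
    rw [hr, (h2.mul_right_eq_zero).mp hi, DihedralGroup.one_def]
  · simp only [ξ_mul, υ_mul, ξ_inv, υ_inv, ζ_inv, hr, eps_sr, aPar_sr, rotIdx_sr, qPar, DihedralGroup.inv_sr, ξ_mk, υ_mk, ζ_mk,
      mk_right, SemidirectProduct.mul_right, mul_one, mul_zero, add_zero] at hx
    have hi : (2 : ZMod l) * (i - 1) = 0 := by linear_combination hx
    have := (h2.mul_right_eq_zero).mp hi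
    right
    rw [hr, show i = 1 by linear_combination this]

/-- `(1, −1, 0) ⋊ 1 ∈ Π_{X̲̲}`-part. (toy bookkeeping; no claim about print) [cite: MochizukiEtTh2009, Cor 2.9 p.43] -/
theorem e_mem_kumXuu : mk l 1 (-1) 0 1 ∈ kumXuu l := ⟨rfl, by simp⟩

/-- **`N(Π_{X̲̲}-part) = Π_{C̲}-part`.** (toy bookkeeping; no claim about print) [cite: MochizukiEtTh2009, Cor 2.9 p.43] -/
theorem normalizer_kumXuu (hl : Odd l) : Subgroup.normalizer ((kumXuu l : Subgroup (kumPiC l)) : Set (kumPiC l)) = kumHp l :=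
  le_antisymm (fun _ hh => mem_kumHp_of_conj_e_mem l hl ((Subgroup.mem_normalizer_iff.mp hh _).mp (e_mem_kumXuu l)))
    (kumHp_le_normalizer_kumXuu l)

/-- **`N(Π_{C̲}-part) = Π_{C̲}-part`** (self-normalising). (toy bookkeeping; no claim about print) [cite: MochizukiEtTh2009, Cor 2.9 p.43] -/
theorem normalizer_kumHp (hl : Odd l) : Subgroup.normalizer ((kumHp l : Subgroup (kumPiC l)) : Set (kumPiC l)) = kumHp l :=
  le_antisymm (fun _ hh => mem_kumHp_of_conj_iota_mem l hl ((Subgroup.mem_normalizer_iff.mp hh _).mp (iota_mem_kumHp l)))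
    Subgroup.le_normalizer

/-- **`N(Π_{C̲̲}-part) = Π_{C̲}-part`.** (toy bookkeeping; no claim about print) [cite: MochizukiEtTh2009, Cor 2.9 p.43] -/
theorem normalizer_kumCuu (hl : Odd l) : Subgroup.normalizer ((kumCuu l : Subgroup (kumPiC l)) : Set (kumPiC l)) = kumHp l := by
  refine le_antisymm (fun _ hh => mem_kumHp_of_conj_iota_mem l hl
    (kumCuu_le_kumHp l ((Subgroup.mem_normalizer_iff.mp hh _).mp (iota_mem_kumCuu l)))) ?_
  rw [← kumCuu_sup_kumZ]
  exact sup_le Subgroup.le_normalizer (kumZ_le_normalizer l _)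

/-- `N(K × 1) = N(K) × ℤ/2` in `kumPiC × ℤ/2` (the second factor is abelian). (toy bookkeeping; no claim about print)
[cite: MochizukiEtTh2009, Cor 2.9 p.43] -/
theorem normalizer_prod_bot (K : Subgroup (kumPiC l)) :
    Subgroup.normalizer ((K.prod (⊥ : Subgroup (Multiplicative (ZMod 2))) :
      Subgroup (kumPiC l × Multiplicative (ZMod 2))) : Set (kumPiC l × Multiplicative (ZMod 2))) =
      (Subgroup.normalizer (K : Set (kumPiC l))).prod ⊤ := by
  ext ⟨a, b⟩
  rw [Subgroup.mem_prod, Subgroup.mem_normalizer_iff, Subgroup.mem_normalizer_iff]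
  constructor
  · intro h
    refine ⟨fun g => ?_, trivial⟩
    have := h (g, 1)
    simp only [Subgroup.mem_prod, Subgroup.mem_bot, and_true, Prod.mk_mul_mk, Prod.inv_mk, mul_one, mul_inv_cancel] at this
    exact this
  · rintro ⟨h, -⟩ ⟨g, t⟩
    simp only [Subgroup.mem_prod, Subgroup.mem_bot, Prod.mk_mul_mk, Prod.inv_mk, mul_inv_cancel_comm, h g]

end KummerWitness

/-! ## 2. The dotted members of the model and the full typed `Cor29_card` -/

namespace KummerModel

open Multiplicative KummerWitness Literature.AnabelianGeometry.SemiGraphs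
  Literature.AnabelianGeometry.EtaleTheta.SettingModel TemperedModel

variable (l : ℕ) [NeZero l]

omit [NeZero l] in
/-- A dotted member `Φ^tp⁻¹(K) ∩ Π^tp_Ċ` is the preimage of `K × 1` under `(Φ^tp, two) : Π^tp_C → kumPiC × ℤ/2`. (toy bookkeeping)
[cite: MochizukiEtTh2009, Def 2.5 (ii) p.39] -/
theorem comap_inf_PiCdot_eq (K : Subgroup (kumPiC l)) :
    K.comap (PhiG l) ⊓ ((TK.two l).ker).prod (⊤ : Subgroup (Multiplicative ℤ)) =
      (K.prod (⊥ : Subgroup (Multiplicative (ZMod 2)))).comap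
        ((PhiG l).prod ((TK.two l).comp (MonoidHom.fst (TK l) (Multiplicative ℤ)))) := by
  ext x
  simp only [Subgroup.mem_inf, Subgroup.mem_comap, Subgroup.mem_prod, MonoidHom.mem_ker, Subgroup.mem_top, and_true,
    Subgroup.mem_bot, MonoidHom.prod_apply, MonoidHom.coe_comp, MonoidHom.coe_fst, Function.comp_apply]

omit [NeZero l] in
/-- `(Φ^tp, two) : Π^tp_C → kumPiC × ℤ/2` is onto. (toy bookkeeping) [cite: MochizukiEtTh2009, Def 2.5 (ii) p.39] -/
theorem PhiG_prod_two_surjective :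
    Function.Surjective ((PhiG l).prod ((TK.two l).comp (MonoidHom.fst (TK l) (Multiplicative ℤ)))) := fun y =>
  ⟨(TK.inK l y.1 y.2, 1), Prod.ext rfl rfl⟩

omit [NeZero l] in
/-- **The normaliser of a dotted member**: if `N(K) = Π_{C̲}-part` in the toy, then `N(Φ^tp⁻¹(K) ∩ Π^tp_Ċ) = Φ^tp⁻¹(Π_{C̲}-part) = Π^tp_{C̲}`.
(toy bookkeeping) [cite: MochizukiEtTh2009, Cor 2.9 p.43] -/
theorem normalizer_comap_inf_PiCdot (K : Subgroup (kumPiC l)) (hK : Subgroup.normalizer (K : Set (kumPiC l)) = kumHp l) :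
    Subgroup.normalizer ((K.comap (PhiG l) ⊓ ((TK.two l).ker).prod (⊤ : Subgroup (Multiplicative ℤ)) : Subgroup (GtpK l)) :
      Set (GtpK l)) = (kumHp l).comap (PhiG l) := by
  rw [comap_inf_PiCdot_eq, ← Subgroup.comap_normalizer_eq_of_surjective _ (PhiG_prod_two_surjective l), normalizer_prod_bot, hK]
  ext x
  simp only [Subgroup.mem_comap, Subgroup.mem_prod, Subgroup.mem_top, and_true, MonoidHom.prod_apply]

/-- **THE KUMMER-TWIST MODEL satisfies the FULL typed `Cor29_card`** (core form, units `k m = 1` of `ℤ/l`, `k ≠ ±1`): there is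
`T : ThetaCovers.TemperedCoverData l` with `HasMuL`, `Cor29_card` (all six members: `(l+1)/2` `Aut_K`-orbits of cusps each), `hΘ`, `hC1`,
`hC2`, and `¬ Cor29_preserved`. The undotted counts and the refutation are those of `exists_model`; the dotted counts come from
`normalizer_comap_inf_PiCdot` and abc-iut-L2-d3's `natCard_cuspOrbits_of_normalizer_eq`. CONSISTENCY/INDEPENDENCE certificate on the typed
interface only. [cite: MochizukiEtTh2009, Cor 2.9 p.43] -/
theorem exists_model_cor29_card (hl : Odd l) (h5 : 5 ≤ l) :
    ∃ T : TemperedCoverData.{0} l, T.HasMuL ∧ T.Cor29_card ∧ ¬ T.Cor29_preserved := by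
  -- `k = 2`, `m = (l+1)/2`
  obtain ⟨k0, hk0⟩ := hl
  have hkm : (2 : ZMod l) * ((k0 : ZMod l) + 1) = 1 := by
    have h0 : ((2 * k0 + 1 : ℕ) : ZMod l) = 0 := by rw [← hk0]; exact ZMod.natCast_self l
    have h1 : (2 : ZMod l) * k0 + 1 = 0 := by exact_mod_cast h0
    linear_combination h1
  have hval : ∀ a : ℕ, a < l → ((a : ℕ) : ZMod l) = 0 → a = 0 := by
    intro a ha h
    have := congrArg ZMod.val h
    rwa [ZMod.val_natCast, ZMod.val_zero, Nat.mod_eq_of_lt ha] at this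
  have hk1 : (2 : ZMod l) ≠ 1 := fun h => by
    have h1 : ((1 : ℕ) : ZMod l) = 0 := by push_cast; linear_combination h
    exact absurd (hval 1 (by omega) h1) one_ne_zero
  have hk2 : (2 : ZMod l) ≠ -1 := fun h => by
    have h3 : ((3 : ℕ) : ZMod l) = 0 := by push_cast; linear_combination h
    exact absurd (hval 3 (by omega) h3) (by norm_num)
  have hl' : Odd l := ⟨k0, hk0⟩
  -- the model of `exists_model`, rebuilt so that its dotted members can be computed
  haveI := TKX_normal l
  haveI : ((TKX l).prod (⊥ : Subgroup (Multiplicative ℤ))).Normal := Subgroup.prod_normal _ _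
  let T : TemperedCoverData.{0} l :=
    { toCoverDataAx := coverDataAx l hl'
      PiCuu := PiCuuK l
      isTypeLTorsThetaPm := isTypeLTorsThetaPm_PiCuuK l hl'
      isOpen_PiCuu' := isOpen_PiCuuK l
      Gtp := GtpK l
      toHat := (toHatK l).toMonoidHom
      continuous_toHat := (toHatK l).continuous
      injective_toHat := toHatK_injective l
      isProfiniteCompletion_toHat := isProfiniteCompletion_toHatK l
      PiYtp := (TKX l).prod ⊥
      PiYtp_le := by
        change (TKX l).prod ⊥ ≤ (PiXK l).comap (toHatK l).toMonoidHom
        rw [comap_toHatK_PiXK]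
        exact Subgroup.prod_mono le_rfl bot_le
      PiYtp_normal := inferInstance
      isOpen_PiYtp := isOpen_discrete _
      quotZ := nonempty_quotZ l
      PiYddtp := ((TKX l ⊓ (TK.two l).ker)).prod ⊥
      PiYddtp_le := Subgroup.prod_mono inf_le_left le_rfl
      isOpen_PiYddtp := isOpen_discrete _
      relIndex_PiYddtp := relIndex_PiYddtp l
      PiCdot := ((TK.two l).ker).prod ⊤
      index_PiCdot := index_PiCdot l
      isOpen_PiCdot := isOpen_discrete _
      PiCdot_ne := PiCdot_ne l }
  have hCu : T.tp T.PiCu = (kumHp l).comap (PhiG l) := tp_PiCu l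
  have hXu : T.tp T.PiXu = (kumH l).comap (PhiG l) := tp_PiXu l
  have hXuu : T.tp T.PiXuu = (kumXuu l).comap (PhiG l) := tp_PiXuu l
  have hCuu : T.tp T.PiCuu = (kumCuu l).comap (PhiG l) := tp_PiCuu l
  have hX : T.tp T.PiX = (kumPiX l).comap (PhiG l) := tp_PiX l
  have hdot : T.PiCdot = ((TK.two l).ker).prod ⊤ := rfl
  have hstab : T.cuspStabC = (kumHp l).comap (PhiG l) := by
    change Subgroup.normalizer (((DxK l).comap (toHatK l).toMonoidHom : Subgroup (GtpK l)) : Set (GtpK l)) = _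
    rw [tp_Dx]
    exact normalizer_tpDx l
  have hμ : T.HasMuL := fun c t ht => hasMuL_model l c ht
  have hΘ : ⁅T.DeltaX, T.DeltaX⁆ ⊔ T.barKer = T.barTheta := commutator_sup_barKer l hl'
  have hC1 : T.cuspStabC ⊓ T.tp T.PiX ≤ T.tp T.PiXu := by
    rw [hstab, hX, hXu, ← Subgroup.comap_inf, kumHp_inf_kumPiX]
  have hC2 : ¬ T.cuspStabC ≤ T.tp T.PiX := by
    rw [hstab, hX]
    intro h
    exact iota_not_mem_kumPiX l (h (show iotaG l ∈ (kumHp l).comap (PhiG l) from iota_mem_kumHp l))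
  -- the full typed count
  have hcard : T.Cor29_card := by
    intro _ S hS
    simp only [List.mem_cons, List.not_mem_nil, or_false] at hS
    rcases hS with rfl | rfl | rfl | rfl | rfl | rfl
    · refine T.natCard_cuspOrbits_of_normalizer_eq hC1 hC2 ?_
      rw [hXuu, hdot, hCu]; exact normalizer_comap_inf_PiCdot l _ (normalizer_kumXuu l hl')
    · refine T.natCard_cuspOrbits_of_normalizer_eq hC1 hC2 ?_
      rw [hCu, hdot]; exact normalizer_comap_inf_PiCdot l _ (normalizer_kumHp l hl')
    · refine T.natCard_cuspOrbits_of_normalizer_eq hC1 hC2 ?_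
      rw [hCuu, hdot, hCu]; exact normalizer_comap_inf_PiCdot l _ (normalizer_kumCuu l hl')
    · exact T.cor29_card_undotted_of hΘ hC1 hC2 hμ _ (by simp)
    · exact T.cor29_card_undotted_of hΘ hC1 hC2 hμ _ (by simp)
    · exact T.cor29_card_undotted_of hΘ hC1 hC2 hμ _ (by simp)
  refine ⟨T, hμ, hcard, fun hC => ?_⟩
  -- `Γ := Θ_2 × id × id` refutes `Cor29_preserved` (as in `exists_model`)
  let ΓA : GtpK l ≃* GtpK l :=
    { toFun := fun x => ((Theta l 2 _ hkm x.1.1, x.1.2), x.2)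
      invFun := fun x => (((Theta l 2 _ hkm).symm x.1.1, x.1.2), x.2)
      left_inv := fun x => by simp only [MulEquiv.symm_apply_apply]; rfl
      right_inv := fun x => by simp only [MulEquiv.apply_symm_apply]; rfl
      map_mul' := fun x y => Prod.ext (Prod.ext (map_mul (Theta l 2 _ hkm) x.1.1 y.1.1) rfl) rfl }
  let Γ : T.Gtp ≃ₜ* T.Gtp :=
    { ΓA with
      continuous_toFun := continuous_of_discreteTopology
      continuous_invFun := continuous_of_discreteTopology }
  have hΓΦ : ∀ x : GtpK l, PhiG l (Γ.toMulEquiv.symm x) = (Theta l 2 _ hkm).symm (PhiG l x) := fun _ => rfl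
  have hHp : ((kumHp l).comap (PhiG l)).map Γ.toMulEquiv.toMonoidHom = (kumHp l).comap (PhiG l) :=
    map_comap_PhiG_eq l hΓΦ _ (mem_kumHp_theta_iff l hkm)
  let gR : GtpK l := (TK.inK l (SemidirectProduct.inr (DihedralGroup.r 1)) 1, 1)
  have key := hC hμ (T.tp T.PiCu, [T.tp T.PiCu, T.tp T.PiXu, T.tp T.PiX, T.PiYddtp]) (by simp) Γ ?_ ?_ gR
  rotate_left
  · intro S' hS'
    simp only [List.mem_cons, List.not_mem_nil, or_false] at hS'
    rcases hS' with rfl | rfl | rfl | rfl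
    · rw [hCu]; exact hHp
    · rw [hXu]; exact map_comap_PhiG_eq l hΓΦ _ (mem_kumH_theta_iff l hkm)
    · rw [hX]; exact map_comap_PhiG_eq l hΓΦ _ (mem_kumPiX_theta_iff l hkm)
    · change (((TKX l ⊓ (TK.two l).ker)).prod (⊥ : Subgroup (Multiplicative ℤ))).map Γ.toMulEquiv.toMonoidHom =
        ((TKX l ⊓ (TK.two l).ker)).prod ⊥
      ext x
      rw [Subgroup.mem_map_equiv, mem_PiYddtp_iff, mem_PiYddtp_iff]
      change ((Theta l 2 _ hkm).symm (TK.kum l x.1) ∈ kumPiX l ∧ TK.two l x.1 = 1 ∧ x.2 = 1) ↔ _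
      rw [← mem_kumPiX_theta_iff l hkm ((Theta l 2 _ hkm).symm (TK.kum l x.1)), MulEquiv.apply_symm_apply]
  · rw [hstab]; exact hHp
  change DoubleCoset.mk (Subgroup.normalizer ((T.tp T.PiCu : Subgroup (GtpK l)) : Set (GtpK l))) T.cuspStabC (Γ gR) =
    DoubleCoset.mk _ _ gR at key
  rw [DoubleCoset.eq] at key
  obtain ⟨x, hx, y, hy, hxy⟩ := key
  rw [hCu] at hx
  rw [hstab] at hy
  have hx' : (PhiG l x).right = 1 ∨ (PhiG l x).right = DihedralGroup.sr 1 := by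
    have hι : iotaG l ∈ (kumHp l).comap (PhiG l) := iota_mem_kumHp l
    have h := (Subgroup.mem_normalizer_iff.mp hx (iotaG l)).mp hι
    have h' : PhiG l x * iota l * (PhiG l x)⁻¹ ∈ kumHp l := by
      have h'' : PhiG l (x * iotaG l * x⁻¹) ∈ kumHp l := h
      rwa [map_mul, map_mul, map_inv] at h''
    exact mem_kumHp_of_conj_iota_mem l hl' h'
  have hy' : (PhiG l y).right = 1 ∨ (PhiG l y).right = DihedralGroup.sr 1 := hy
  have e := congrArg (fun z : GtpK l => cls l (PhiG l z).right) hxy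
  simp only [map_mul, SemidirectProduct.mul_right] at e
  have eR : (PhiG l gR).right = DihedralGroup.r 1 := rfl
  have eΓ : (PhiG l (Γ gR)).right = DihedralGroup.r 2 := by
    change dihFun l 2 (DihedralGroup.r 1) = DihedralGroup.r 2
    rw [dihFun_r, mul_one]
  rw [eR, eΓ, cls_r] at e
  rcases cls_mul_of_mem l hx' hy' (d := DihedralGroup.r 2) with h | h
  · rw [h, cls_r] at e
    exact hk1 e.symm
  · rw [h, cls_r] at e
    exact hk2 (by linear_combination e)

/-- **FACT-LIST F-0600 (`Cor29_card`), INSTANCE FORM (full typed statement)**: the typed count of [EtTh] Cor 2.9 HOLDS at a kernel model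
with `K ⊇ μ_l` (`l` odd, `l ≥ 5`) — consistent with the interface; its universal closure stays refuted (abc-iut-w5-d118).
[cite: MochizukiEtTh2009, Cor 2.9 p.43] -/
theorem exists_model_hasMuL_and_cor29_card (hl : Odd l) (h5 : 5 ≤ l) :
    ∃ T : TemperedCoverData.{0} l, T.HasMuL ∧ T.Cor29_card := by
  obtain ⟨T, h1, h2, -⟩ := exists_model_cor29_card l hl h5
  exact ⟨T, h1, h2⟩

/-- **`HasMuL ∧ Cor29_card ⇏ Cor29_preserved`** (FACT-LIST F-0600/F-0601; `l` odd, `l ≥ 5`): the typed COUNT of [EtTh] Cor 2.9 does not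
imply the typed PRESERVATION over the interface (with abc-iut-f-142's converse: the two typed sentences are INDEPENDENT).
[cite: MochizukiEtTh2009, Cor 2.9 p.43] -/
theorem not_forall_cor29_preserved_of_cor29_card (hl : Odd l) (h5 : 5 ≤ l) :
    ¬ ∀ T : TemperedCoverData.{0} l, T.HasMuL → T.Cor29_card → T.Cor29_preserved := by
  obtain ⟨T, h1, h2, h3⟩ := exists_model_cor29_card l hl h5
  exact fun h => h3 (h T h1 h2)

/-- The same at `l = 5`, closed form. [cite: MochizukiEtTh2009, Cor 2.9 p.43] -/
theorem not_forall_cor29_preserved_of_cor29_card_five :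
    ¬ ∀ T : TemperedCoverData.{0} 5, T.HasMuL → T.Cor29_card → T.Cor29_preserved :=
  not_forall_cor29_preserved_of_cor29_card 5 ⟨2, rfl⟩ le_rfl

end KummerModel

end ThetaCovers

end Literature.AnabelianGeometry.EtaleTheta
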